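import Summits.Parity.GeneralizedHardyLittlewood.Theorems.PrimeLevelFamEdgeMomentsBeyondDiagonalDiagDecorCollapse
import Summits.Parity.GeneralizedHardyLittlewood.Theorems.PrimeLevelFamEdgeMomentsBeyondDiagonalDiagDecorEuler
import Mathlib.Data.Nat.Squarefree
import HarnessLib

/-!
# Route `PrimeLevelFamEdge`, crux K_A `MomentsBeyondDiagonal` (stmt-Parity-20007), line «petersson_layers» v4, stub `stub_diag`:
# **the `(c,g) ↦ n` collapse of the decorated Selberg coordinates — the BOUND for every power `(log g)^r`, `r ≥ 1`:
# `|Σ_{c≤N}Σ_{g≤N/c} μ(g)·c·(log g)^r·W(cg)²F(cg)| ≤ (log N)^{r−1}·Σ_{n≤N} |W(n)|·κ(n)·|F(n)|`**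

Census R3(ii), ANALYTIC HALF, companion of `…DiagDecorCollapse` (exact collapses for `r = 0, 1`). In the order-`(i,j)`
target of `…DiagOrderSelberg` a monomial of the weight carrying `(log g)^r`, `r ≥ 1`, is one logarithm BELOW its formal
degree: it is an error term, and a bound saving exactly one logarithm suffices (the target precision is one log below
the main term). For squarefree `n` (the only `n` with `W(n) ≠ 0`, `W = μ/(id·ψ)`):

* `sum_divisors_filter_dvd_eq_sum_divisors_div` — prime peeling `Σ_{g∣n, p∣g} f(g) = Σ_{g′∣n/p} f(pg′)`;
* `log_eq_sum_primeFactors_log` — `log g = Σ_{p∣g} log p` for squarefree `g`;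
* `sum_divisors_mul_log_eq_sum_primeFactors` — `Σ_{g∣n} f(g)·log g = Σ_{p∣n} log p·Σ_{g′∣n/p} f(pg′)` (squarefree `n`);
* `mul_sum_divisors_div_le` — `p·σ(n/p) ≤ σ(n)` for `p ∣ n` (`σ(m) = Σ_{d∣m} d`);
* `sum_divisors_div_mul_log_pow_le` — **`Σ_{g∣n}(n/g)(log g)^r ≤ (log n)^{r−1}·σ(n)·κ(n)`** (squarefree `n`, `r ≥ 1`), hence
  `abs_sum_divisors_moebius_mul_div_mul_log_pow_le`: `|Σ_{g∣n} μ(g)(n/g)(log g)^r| ≤ (log n)^{r−1}σ(n)κ(n)`;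
* `cast_mul_psi_eq_sum_divisors` — `n·ψ(n) = σ(n)` for squarefree `n`, so `W_sq_mul_sum_divisors`: `W(n)²·σ(n) = |W(n)|`;
* `abs_selbergCollapse_logPow_le` — **the collapse bound displayed above** (`r ≥ 1`, any `F`).

With `|W(n)| ≤ 1/n` and the tree's `Σ_{n≤N}κ(n)D(n)²/n ≤ C(2+log N)` (`KernelFormXSqSumsB.sum_kappa_divWeight_sq_div_le`) every
`(log g)^r`-monomial of the order-`(i,j)` weight is `O(q̂ℓ^{i+j−3})` once its `k`-sums are bounded by `C·D(n)(1+κ(n))·log^{d−2}M`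
(`…DiagDecorProfileCoord`; `κ(n) ≤ log n` for the surplus `κ`'s). Def-free; theorems only. Helper `--supports stmt-Parity-20007`;
closes nothing; K_A, K_B and the Parity summit are NOT proved; nothing about Landau–Siegel zeros.

## References
* E. Kowalski, P. Michel, J. VanderKam, J. reine angew. Math. 526 (2000), (23) p. 13 (the `κ(n)`-terms of the Selberg
  diagonalisation are lower order). [cite: KowalskiMichelVanderKam2000, (23)–(28) — derivation (collapse bounds for the log g powers)]
-/

noncomputable section

open scoped Real ArithmeticFunction.Moebius
open Finset ArithmeticFunction

namespace Summit.Parity.GeneralizedHardyLittlewood.Theorems.MomentsBeyondDiagonal.DiagKernel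

open Literature.NumberTheory.LFunctions Literature.NumberTheory.LFunctions.KMV2000
open MollifierMainTerm (W)
open SelbergCoord (kappa)
open Summit.Parity.GeneralizedHardyLittlewood.Theorems.BeyondDiagonalBeatsQuarter.KernelFormXSq
  (W_apply'' W_eq_zero_of_not_squarefree abs_W_eq)

/-! ### Prime peeling on the divisors of a squarefree number -/

/-- `Σ_{g∣n, p∣g} f(g) = Σ_{g′∣n/p} f(p·g′)` for `p ∣ n`, `n ≥ 1`, `p ≥ 1`. [folklore] -/
theorem sum_divisors_filter_dvd_eq_sum_divisors_div {β : Type*} [AddCommMonoid β] {n p : ℕ} (hn : n ≠ 0)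
    (hp : p ≠ 0) (hpn : p ∣ n) (f : ℕ → β) :
    ∑ g ∈ n.divisors.filter (fun g ↦ p ∣ g), f g = ∑ g ∈ (n / p).divisors, f (p * g) := by
  have hsub : n.divisors.filter (fun g ↦ p ∣ g) = ((n / p).divisors).image (fun g ↦ p * g) := by
    ext g
    simp only [Finset.mem_filter, Nat.mem_divisors, Finset.mem_image]
    constructor
    · rintro ⟨⟨hgn, -⟩, ⟨g', rfl⟩⟩
      refine ⟨g', ⟨?_, (Nat.div_ne_zero_iff_of_dvd hpn).2 ⟨hn, hp⟩⟩, rfl⟩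
      obtain ⟨m, hm⟩ := hgn
      refine ⟨m, ?_⟩
      rw [hm, mul_assoc, Nat.mul_div_cancel_left _ (Nat.pos_of_ne_zero hp)]
    · rintro ⟨g', ⟨hg', -⟩, rfl⟩
      refine ⟨⟨?_, hn⟩, dvd_mul_right p g'⟩
      have := Nat.mul_dvd_mul_left p hg'
      rwa [Nat.mul_div_cancel' hpn] at this
  rw [hsub, Finset.sum_image fun a _ b _ h ↦ (Nat.mul_right_inj hp).1 h]

/-- `log g = Σ_{p∣g} log p` for squarefree `g`. [folklore] -/
theorem log_eq_sum_primeFactors_log {g : ℕ} (hg : Squarefree g) :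
    Real.log g = ∑ p ∈ g.primeFactors, Real.log p := by
  conv_lhs => rw [← Nat.prod_primeFactors_of_squarefree hg]
  push_cast
  rw [Real.log_prod]
  intro p hp
  exact_mod_cast (Nat.prime_of_mem_primeFactors hp).ne_zero

/-- **Prime peeling of a `log`-weighted divisor sum**: `Σ_{g∣n} f(g)·log g = Σ_{p∣n} log p·Σ_{g′∣n/p} f(p·g′)` for
squarefree `n`. [folklore] -/
theorem sum_divisors_mul_log_eq_sum_primeFactors {n : ℕ} (hn : Squarefree n) (f : ℕ → ℝ) :
    ∑ g ∈ n.divisors, f g * Real.log g = ∑ p ∈ n.primeFactors, Real.log p * ∑ g ∈ (n / p).divisors, f (p * g) := by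
  have hn0 : n ≠ 0 := hn.ne_zero
  -- `log g` as a sum over the prime factors of `n` dividing `g`
  have h1 : ∀ g ∈ n.divisors, f g * Real.log g = ∑ p ∈ n.primeFactors, (if p ∣ g then f g * Real.log p else 0) := by
    intro g hg
    have hgn : g ∣ n := Nat.dvd_of_mem_divisors hg
    have hgsq : Squarefree g := hn.squarefree_of_dvd hgn
    rw [log_eq_sum_primeFactors_log hgsq, Finset.mul_sum, ← Finset.sum_filter]
    have hset : n.primeFactors.filter (fun p ↦ p ∣ g) = g.primeFactors := by
      ext p
      simp only [Finset.mem_filter, Nat.mem_primeFactors_of_ne_zero hn0,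
        Nat.mem_primeFactors_of_ne_zero (Nat.pos_of_mem_divisors hg).ne']
      constructor
      · rintro ⟨⟨hp, -⟩, hpg⟩; exact ⟨hp, hpg⟩
      · rintro ⟨hp, hpg⟩; exact ⟨⟨hp, hpg.trans hgn⟩, hpg⟩
    rw [hset]
  rw [Finset.sum_congr rfl h1, Finset.sum_comm]
  refine Finset.sum_congr rfl fun p hp ↦ ?_
  have hp' := (Nat.mem_primeFactors_of_ne_zero hn0).1 hp
  rw [← Finset.sum_filter, sum_divisors_filter_dvd_eq_sum_divisors_div hn0 hp'.1.ne_zero hp'.2, Finset.mul_sum]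
  exact Finset.sum_congr rfl fun g _ ↦ mul_comm _ _

/-- `p·σ(n/p) ≤ σ(n)` for `p ∣ n`, `n ≥ 1` (`σ(m) = Σ_{d∣m} d`; the divisors `p·d`, `d ∣ n/p`, of `n` are distinct).
[folklore] -/
theorem mul_sum_divisors_div_le {n p : ℕ} (hn : n ≠ 0) (hp : p ≠ 0) (hpn : p ∣ n) :
    (p : ℝ) * ∑ d ∈ (n / p).divisors, (d : ℝ) ≤ ∑ e ∈ n.divisors, (e : ℝ) := by
  rw [Finset.mul_sum]
  have h := sum_divisors_filter_dvd_eq_sum_divisors_div hn hp hpn (fun e ↦ (e : ℝ))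
  push_cast at h
  rw [← h]
  exact Finset.sum_le_sum_of_subset_of_nonneg (Finset.filter_subset _ _) fun e _ _ ↦ Nat.cast_nonneg e

/-! ### The bound for `Σ_{g∣n}(n/g)(log g)^r` -/

/-- `Σ_{g∣n}(n/g)·log g ≤ σ(n)·κ(n)` for squarefree `n` (`= Σ_{p∣n} log p·σ(n/p)`, `σ(n/p) ≤ σ(n)/p`, `1/p ≤ 1/(p−1)`).
[folklore] -/
theorem sum_divisors_div_mul_log_le {n : ℕ} (hn : Squarefree n) :
    ∑ g ∈ n.divisors, ((n / g : ℕ) : ℝ) * Real.log g ≤ (∑ d ∈ n.divisors, (d : ℝ)) * kappa n := by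
  have hn0 : n ≠ 0 := hn.ne_zero
  rw [sum_divisors_mul_log_eq_sum_primeFactors hn, kappa, Finset.mul_sum]
  refine Finset.sum_le_sum fun p hp ↦ ?_
  have hp' := (Nat.mem_primeFactors_of_ne_zero hn0).1 hp
  have hp0 : p ≠ 0 := hp'.1.ne_zero
  have hp2 : (2 : ℝ) ≤ p := by exact_mod_cast hp'.1.two_le
  have hpR : (0 : ℝ) < p := by linarith
  have hlp : 0 ≤ Real.log p := Real.log_nonneg (by linarith)
  have hσ0 : 0 ≤ ∑ d ∈ n.divisors, (d : ℝ) := Finset.sum_nonneg fun d _ ↦ Nat.cast_nonneg d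
  -- `Σ_{g′∣n/p} n/(pg′) = σ(n/p)`
  have hσ : ∑ g ∈ (n / p).divisors, ((n / (p * g) : ℕ) : ℝ) = ∑ d ∈ (n / p).divisors, (d : ℝ) := by
    rw [← Nat.sum_div_divisors (n / p) (fun d ↦ (d : ℝ))]
    refine Finset.sum_congr rfl fun g _ ↦ ?_
    rw [Nat.div_div_eq_div_mul]
  rw [hσ]
  have hle : (p : ℝ) * ∑ d ∈ (n / p).divisors, (d : ℝ) ≤ ∑ e ∈ n.divisors, (e : ℝ) :=
    mul_sum_divisors_div_le hn0 hp0 hp'.2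
  have hdiv : ∑ d ∈ (n / p).divisors, (d : ℝ) ≤ (∑ e ∈ n.divisors, (e : ℝ)) / p := by
    rw [le_div_iff₀ hpR]; linarith
  have hinv : (1 : ℝ) / p ≤ 1 / ((p : ℝ) - 1) :=
    one_div_le_one_div_of_le (by linarith) (by linarith)
  calc Real.log p * ∑ d ∈ (n / p).divisors, (d : ℝ)
      ≤ Real.log p * ((∑ e ∈ n.divisors, (e : ℝ)) / p) := mul_le_mul_of_nonneg_left hdiv hlp
    _ = (∑ e ∈ n.divisors, (e : ℝ)) * Real.log p * (1 / p) := by ring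
    _ ≤ (∑ e ∈ n.divisors, (e : ℝ)) * Real.log p * (1 / ((p : ℝ) - 1)) :=
        mul_le_mul_of_nonneg_left hinv (by positivity)
    _ = (∑ e ∈ n.divisors, (e : ℝ)) * (Real.log p / ((p : ℝ) - 1)) := by ring

/-- **`Σ_{g∣n}(n/g)·(log g)^r ≤ (log n)^{r−1}·σ(n)·κ(n)`** for squarefree `n` and `r ≥ 1`. [folklore] -/
theorem sum_divisors_div_mul_log_pow_le {n : ℕ} (hn : Squarefree n) {r : ℕ} (hr : 1 ≤ r) :
    ∑ g ∈ n.divisors, ((n / g : ℕ) : ℝ) * Real.log g ^ r ≤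
      Real.log n ^ (r - 1) * (∑ d ∈ n.divisors, (d : ℝ)) * kappa n := by
  have hn0 : n ≠ 0 := hn.ne_zero
  have hterm : ∀ g ∈ n.divisors, ((n / g : ℕ) : ℝ) * Real.log g ^ r ≤
      Real.log n ^ (r - 1) * (((n / g : ℕ) : ℝ) * Real.log g) := by
    intro g hg
    have hgn : g ∣ n := Nat.dvd_of_mem_divisors hg
    have hg1 : (1 : ℝ) ≤ g := by exact_mod_cast Nat.pos_of_mem_divisors hg
    have hgn' : (g : ℝ) ≤ n := by exact_mod_cast Nat.le_of_dvd (Nat.pos_of_ne_zero hn0) hgn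
    have hlg : 0 ≤ Real.log g := Real.log_nonneg hg1
    have hlgn : Real.log g ≤ Real.log n := Real.log_le_log (by linarith) hgn'
    have e : r = (r - 1) + 1 := by omega
    calc ((n / g : ℕ) : ℝ) * Real.log g ^ r = ((n / g : ℕ) : ℝ) * (Real.log g ^ (r - 1) * Real.log g) := by
          conv_lhs => rw [e, pow_succ]
      _ ≤ ((n / g : ℕ) : ℝ) * (Real.log n ^ (r - 1) * Real.log g) := by
          gcongr
      _ = Real.log n ^ (r - 1) * (((n / g : ℕ) : ℝ) * Real.log g) := by ring
  have hln : 0 ≤ Real.log n := Real.log_natCast_nonneg n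
  calc ∑ g ∈ n.divisors, ((n / g : ℕ) : ℝ) * Real.log g ^ r
      ≤ ∑ g ∈ n.divisors, Real.log n ^ (r - 1) * (((n / g : ℕ) : ℝ) * Real.log g) := Finset.sum_le_sum hterm
    _ = Real.log n ^ (r - 1) * ∑ g ∈ n.divisors, ((n / g : ℕ) : ℝ) * Real.log g := by rw [Finset.mul_sum]
    _ ≤ Real.log n ^ (r - 1) * ((∑ d ∈ n.divisors, (d : ℝ)) * kappa n) :=
        mul_le_mul_of_nonneg_left (sum_divisors_div_mul_log_le hn) (by positivity)
    _ = _ := by ring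

/-- **`|Σ_{g∣n} μ(g)(n/g)(log g)^r| ≤ (log n)^{r−1}·σ(n)·κ(n)`** for squarefree `n`, `r ≥ 1`.
[cite: KowalskiMichelVanderKam2000, (23) — derivation] -/
theorem abs_sum_divisors_moebius_mul_div_mul_log_pow_le {n : ℕ} (hn : Squarefree n) {r : ℕ} (hr : 1 ≤ r) :
    |∑ g ∈ n.divisors, (μ g : ℝ) * ((n / g : ℕ) : ℝ) * Real.log g ^ r| ≤
      Real.log n ^ (r - 1) * (∑ d ∈ n.divisors, (d : ℝ)) * kappa n := by
  refine (Finset.abs_sum_le_sum_abs _ _).trans (le_trans (Finset.sum_le_sum fun g hg ↦ ?_)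
    (sum_divisors_div_mul_log_pow_le hn hr))
  have hg1 : (1 : ℝ) ≤ g := by exact_mod_cast Nat.pos_of_mem_divisors hg
  have hlg : 0 ≤ Real.log g := Real.log_nonneg hg1
  have h1 : |(μ g : ℝ) * ((n / g : ℕ) : ℝ) * Real.log g ^ r| = |(μ g : ℝ)| * (((n / g : ℕ) : ℝ) * Real.log g ^ r) := by
    rw [mul_assoc, abs_mul, abs_of_nonneg (mul_nonneg (Nat.cast_nonneg (n / g)) (pow_nonneg hlg r))]
  have hμ : |(μ g : ℝ)| ≤ 1 := by exact_mod_cast ArithmeticFunction.abs_moebius_le_one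
  rw [h1]
  calc |(μ g : ℝ)| * (((n / g : ℕ) : ℝ) * Real.log g ^ r) ≤ 1 * (((n / g : ℕ) : ℝ) * Real.log g ^ r) := by gcongr
    _ = _ := by ring

/-! ### `W(n)²σ(n) = |W(n)|` on squarefree `n` -/

/-- `n·ψ(n) = σ(n) = Σ_{d∣n} d` for squarefree `n` (`ψ(n) = Π_{p∣n}(1+1/p)`, `n = Π_{p∣n} p`). [folklore] -/
theorem cast_mul_psi_eq_sum_divisors {n : ℕ} (hn : Squarefree n) :
    (n : ℝ) * psi n = ∑ d ∈ n.divisors, (d : ℝ) := by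
  have hprod : ∑ d ∈ n.divisors, (d : ℝ) = ∏ p ∈ n.primeFactors, ((p : ℝ) + 1) := by
    have h := DiagLines.sum_divisors_mul_eq_prod_of_squarefree
      (fun d : ℕ ↦ (d : ℝ)) (fun _ ↦ (1 : ℝ)) (by simp) rfl (fun a b ↦ by push_cast; ring) (fun _ _ ↦ by simp) hn
    simpa using h
  rw [hprod, psi]
  have hn' : (n : ℝ) = ∏ p ∈ n.primeFactors, (p : ℝ) := by
    conv_lhs => rw [← Nat.prod_primeFactors_of_squarefree hn]
    push_cast
    rfl
  rw [hn', ← Finset.prod_mul_distrib]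
  refine Finset.prod_congr rfl fun p hp ↦ ?_
  have hp0 : (p : ℝ) ≠ 0 := by exact_mod_cast (Nat.prime_of_mem_primeFactors hp).ne_zero
  field_simp

/-- **`W(n)²·σ(n) = |W(n)|`** for squarefree `n` (`|W(n)| = 1/(nψ(n)) = 1/σ(n)`). [folklore] -/
theorem W_sq_mul_sum_divisors {n : ℕ} (hn : Squarefree n) :
    W n ^ 2 * ∑ d ∈ n.divisors, (d : ℝ) = |W n| := by
  have hn0 : n ≠ 0 := hn.ne_zero
  have hnR : (n : ℝ) ≠ 0 := by exact_mod_cast hn0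
  have hpsi : 0 < psi n := by
    unfold psi
    exact Finset.prod_pos fun p _ ↦ by positivity
  have hμ : ((μ n : ℝ)) ^ 2 = 1 := by
    have := ArithmeticFunction.moebius_sq_eq_one_of_squarefree hn
    exact_mod_cast congrArg (fun z : ℤ ↦ (z : ℝ)) this
  rw [← cast_mul_psi_eq_sum_divisors hn, abs_W_eq, W_apply'' hn0]
  have : (μ n : ℝ) * ((μ n : ℝ) * ((psi n)⁻¹ * (n : ℝ)⁻¹)) = (μ n : ℝ) ^ 2 * ((psi n)⁻¹ * (n : ℝ)⁻¹) := by ring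
  rw [this, hμ, mul_pow, hμ]
  field_simp

/-! ### The collapse bound -/

/-- **The `(log g)^r` collapse bound**: for `r ≥ 1`, every `N` and every `F`,
`|Σ_{c≤N}Σ_{g≤N/c} μ(g)·c·(log g)^r·W(cg)²·F(cg)| ≤ (log N)^{r−1}·Σ_{n≤N} |W(n)|·κ(n)·|F(n)|`.
[cite: KowalskiMichelVanderKam2000, (23)–(28) — derivation (the log g powers are lower order)] -/
theorem abs_selbergCollapse_logPow_le {r : ℕ} (hr : 1 ≤ r) (N : ℕ) (F : ℕ → ℝ) :
    |∑ c ∈ Icc 1 N, ∑ g ∈ Icc 1 (N / c), (μ g : ℝ) * c * Real.log g ^ r * (W (c * g) ^ 2 * F (c * g))| ≤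
      Real.log N ^ (r - 1) * ∑ n ∈ Icc 1 N, |W n| * kappa n * |F n| := by
  rw [sum_Icc_sum_Icc_div_eq_sum_sum_divisors N (fun c g ↦ (μ g : ℝ) * c * Real.log g ^ r * (W (c * g) ^ 2 * F (c * g))),
    Finset.mul_sum]
  refine (Finset.abs_sum_le_sum_abs _ _).trans (Finset.sum_le_sum fun n hn ↦ ?_)
  have hn' := Finset.mem_Icc.1 hn
  have hn0 : n ≠ 0 := by omega
  have hterm : ∀ g ∈ n.divisors, (μ g : ℝ) * ((n / g : ℕ) : ℝ) * Real.log g ^ r * (W (n / g * g) ^ 2 * F (n / g * g)) =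
      (W n ^ 2 * F n) * ((μ g : ℝ) * ((n / g : ℕ) : ℝ) * Real.log g ^ r) := by
    intro g hg
    rw [Nat.div_mul_cancel (Nat.dvd_of_mem_divisors hg)]; ring
  rw [Finset.sum_congr rfl hterm, ← Finset.mul_sum, abs_mul]
  have hκ : 0 ≤ kappa n := by
    unfold kappa
    exact Finset.sum_nonneg fun p hp ↦ by
      have hp2 : (2 : ℝ) ≤ p := by exact_mod_cast (Nat.prime_of_mem_primeFactors hp).two_le
      exact div_nonneg (Real.log_nonneg (by linarith)) (by linarith)
  by_cases hsq : Squarefree n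
  · have hb := abs_sum_divisors_moebius_mul_div_mul_log_pow_le hsq hr
    have hlogn : Real.log n ≤ Real.log N :=
      Real.log_le_log (by exact_mod_cast hn'.1) (by exact_mod_cast hn'.2)
    have hln : 0 ≤ Real.log n := Real.log_natCast_nonneg n
    have hpow : Real.log n ^ (r - 1) ≤ Real.log N ^ (r - 1) := pow_le_pow_left₀ hln hlogn _
    rw [abs_mul, abs_pow, sq_abs]
    calc W n ^ 2 * |F n| * |∑ g ∈ n.divisors, (μ g : ℝ) * ((n / g : ℕ) : ℝ) * Real.log g ^ r|
        ≤ W n ^ 2 * |F n| * (Real.log n ^ (r - 1) * (∑ d ∈ n.divisors, (d : ℝ)) * kappa n) :=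
          mul_le_mul_of_nonneg_left hb (by positivity)
      _ = Real.log n ^ (r - 1) * ((W n ^ 2 * ∑ d ∈ n.divisors, (d : ℝ)) * kappa n * |F n|) := by ring
      _ = Real.log n ^ (r - 1) * (|W n| * kappa n * |F n|) := by rw [W_sq_mul_sum_divisors hsq]
      _ ≤ Real.log N ^ (r - 1) * (|W n| * kappa n * |F n|) :=
          mul_le_mul_of_nonneg_right hpow (by positivity)
  · rw [W_eq_zero_of_not_squarefree hsq]
    simp only [ne_eq, OfNat.ofNat_ne_zero, not_false_eq_true, zero_pow, zero_mul, abs_zero]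
    positivity

end Summit.Parity.GeneralizedHardyLittlewood.Theorems.MomentsBeyondDiagonal.DiagKernel

end
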